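import Literature.NumberTheory.GaloisCohomology.RestrictedRamificationDegreeOne
import Literature.NumberTheory.GaloisCohomology.PoitouTateSelmerStructures
import Literature.NumberTheory.GaloisRepresentations.UnramifiedClassesInertia
import Literature.NumberTheory.GaloisRepresentations.UnramifiedSubgroupMapSurjective
import Literature.NumberTheory.GaloisRepresentations.DecompositionGroupOfCompletion
import Literature.NumberTheory.GaloisRepresentations.IntegralGaloisActionProofs
import Literature.NumberTheory.GaloisRepresentations.AbsGaloisOuterConj
import Literature.NumberTheory.EllipticCurves.KummerSelmerStructure
import HarnessLib

/-!
# `H¹(G_S, M)` = the classes of `H¹(K, M)` that are LOCALLY unramified outside `S`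
# (`loc_v c ∈ H¹_ur(K_v, M)` for the finite `v ∉ S`), for a `G_S`-module `M`

Topic `NumberTheory/GaloisCohomology`; namespace
`Literature.NumberTheory.GaloisRepresentations.DiscreteGaloisModule`.  THEOREMS ONLY (no definition,
no named fact, no `sorry`, no instance, no notation).

Let `K` be a number field, `S` a set of finite places, `M` a discrete `Γ_K`-module unramified outside
`S` (a `G_S`-module, `G_S = Γ_K ⧸ N_S`).  The tree identifies the image of the inflation
`H¹(G_S, M^{N_S}) ↪ H¹(K, M)` (`restrictedInf`) with the classes unramified at every finite `v ∉ S`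
IN THE GLOBAL SENSE `galoisCohomology.IsUnramifiedAt` — restriction to the inertia FIELDS `K̄^{I_𝔓}`,
all `𝔓 ∣ v` (`RestrictedRamificationDegreeOne.mem_range_restrictedInf_iff_forall_isUnramifiedAt`).
Selmer structures (`SelmerStructure.IsUnramifiedOutside`, Howard 2004 Def. 2.1.10) and the tree's
Poitou–Tate theorems (`middleExact_canonical_holds`, `selmerComplement_canonical_holds`) speak instead
of the LOCAL condition `loc_v c ∈ H¹_ur(K_v, M) = ker (H¹(K_v, M) → H¹(K_v^{nr}, M))`
(`DiscreteGaloisModule.unramifiedSubgroup` of the local module `GaloisRep.toLocal v ρ`).  This file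
proves that the two agree for `G_S`-modules (Milne ADT I §4 p. 55: "`H¹(G_S, M) → ∏ H¹(K_v, M)` …
the image is contained in `P¹_S(K, M)`", Lemma 4.8; NSW (1.6.7), VIII §3):

* `forall_inertia_apply_eq_zero_of_localization_mem_unramifiedSubgroup` — cocycle level: if
  `loc_v [f]` is unramified (`v ∉ S`) then `f` VANISHES on every inertia group `I_𝔓`, `𝔓 ∣ v`
  (at the prime `𝔓_v` cut out by the completion, `I_{𝔓_v} = res (I_{K_v})`
  (`inertia_adicCompletionPrime_eq_map_absInertia`) acts trivially, so "principal on `I_{K_v}`"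
  (`oneCocycleClass_mem_unramifiedSubgroup_iff_forall_eq_zero`) means "zero"; the other `I_𝔓` are
  conjugates (`exists_smul_eq_of_mem_primesAbove_holds`, `Ideal.conj_mem_inertia_smul_iff`) and
  `f(g x g⁻¹) = g · f(x)` for `g x g⁻¹ ∈ N_S`);
* **`mem_range_restrictedInf_of_forall_localization_mem_unramifiedSubgroup`** — a class locally
  unramified at every finite `v ∉ S` is inflated from `H¹(G_S, M^{N_S})`
  (`forall_ramificationSubgroup_eq_zero_of_forall_inertia`, `oneCocycleClass_mem_range_restrictedInf_of_forall_eq_zero`);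
* `localization_mem_unramifiedSubgroup_of_mem_range_restrictedInf` — the converse (any `M`); and the
  `iff` `mem_range_restrictedInf_iff_forall_localization_mem_unramifiedSubgroup`;
* **`mem_range_restrictedInf_of_mem_selmerGroup`** — Selmer-structure form: a class of `H¹_𝓖(K, M)`
  for `𝓖` unramified outside a finite `T` all of whose FINITE places lie in `S` is inflated from `G_S`.

## Why (where this is used)

Road «SUR-Λ» of cell `bsd-eis` (Greenberg 2010 Prop. 3.2.1 in the kernel): the finite-level
Poitou–Tate lift produces a class of `H¹_𝓖(K, 𝐃[𝔪ᵏ])`, which must be moved to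
`H¹(K_Σ/K, 𝐃[𝔪ᵏ]) = H¹(G_S, ·)` (Greenberg's arena, `Greenberg2016.RestrictedRamificationBridge`).
Nothing is asserted about any arithmetic object; no case of Poitou–Tate duality or of BSD is proved.

## References
* J. S. Milne, *Arithmetic Duality Theorems*, 2nd ed. (2006), Ch. I §4 (p. 55), Lemma 4.8. [MilneADT2006]
* J. Neukirch, A. Schmidt, K. Wingberg, *Cohomology of Number Fields*, 2nd ed. (2008), (1.6.7),
  VIII §3. [NeukirchSchmidtWingberg2008]
* J. Neukirch, *Algebraic Number Theory* (1999), Ch. I §9 (9.1), (9.4); Ch. II §9 (9.6). [NeukirchANT1999]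
* B. Howard, Compositio Math. 140 (2004), Def. 2.1.10. [Howard2004HeegnerKolyvagin]
-/

noncomputable section

open CategoryTheory Function NumberField IsDedekindDomain Field
open scoped NumberField ContRepresentation

namespace Literature.NumberTheory.GaloisRepresentations

namespace DiscreteGaloisModule

open _root_.TopRep _root_.ContinuousCohomology
open Literature.NumberTheory.GaloisCohomology

variable {K : Type} [Field K] [NumberField K] {M : Type} [AddCommGroup M] [TopologicalSpace M]
  [DiscreteTopology M] (ρ : DiscreteGaloisModule K M) {S : Set (HeightOneSpectrum (𝓞 K))}

/-! ### §1. Cocycle level: locally unramified at `v ∉ S` ⇒ zero on every `I_𝔓`, `𝔓 ∣ v` -/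

omit [NumberField K] in
/-- A crossed homomorphism on a `G_S`-module satisfies `f(g x g⁻¹) = g · f(x)` whenever
`g x g⁻¹ ∈ N_S` (acts trivially). [cite: NeukirchSchmidtWingberg2008, (1.6.7)] -/
theorem contOneCocycles_apply_conj_of_mem_ramificationSubgroup
    (hρ : ramificationSubgroup K S ≤ ContinuousRep.ker ρ) (f : contOneCocycles ρ.toTopRep)
    (g x : absoluteGaloisGroup K) (hx : g * x * g⁻¹ ∈ ramificationSubgroup K S) :
    f.1 (g * x * g⁻¹) = ρ g (f.1 x) := by
  have hmul : ∀ a b : absoluteGaloisGroup K, f.1 (a * b) = f.1 a + ρ a (f.1 b) := fun a b => f.2 a b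
  have hN : ∀ m : M, ρ (g * x * g⁻¹) m = m := fun m =>
    LinearMap.congr_fun ((ContinuousRep.mem_ker ρ _).1 (hρ hx)) m
  have hinv : ρ g (f.1 g⁻¹) = -f.1 g := by
    have h := hmul g g⁻¹
    rw [mul_inv_cancel, contOneCocycles.apply_one] at h
    exact (neg_eq_of_add_eq_zero_right h.symm).symm
  calc f.1 (g * x * g⁻¹)
      = f.1 (g * x) + ρ (g * x) (f.1 g⁻¹) := hmul _ _
    _ = f.1 g + ρ g (f.1 x) + ρ (g * x * g⁻¹) (ρ g (f.1 g⁻¹)) := by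
        rw [hmul g x, show ρ (g * x) (f.1 g⁻¹) = ρ (g * x * g⁻¹) (ρ g (f.1 g⁻¹)) by
          rw [← Module.End.mul_apply, ← map_mul, inv_mul_cancel_right]]
    _ = ρ g (f.1 x) := by rw [hN, hinv, add_neg_cancel_comm]

/-- **If `loc_v [f] ∈ H¹_ur(K_v, M)` at a finite `v ∉ S` (for a `G_S`-module `M`), then the cocycle
`f` vanishes on every inertia group `I_𝔓 ≤ Γ_K`, `𝔓 ∣ v`.**  At `𝔓_v` (the prime of the
completion) `I_{𝔓_v} = res (I_{K_v}) ≤ N_S` acts trivially, so "principal on `I_{K_v}`" is "zero";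
the other `I_𝔓` are `Γ_K`-conjugates of `I_{𝔓_v}`. [cite: MilneADT2006, Ch. I §4 (p. 55) and Lemma 4.8]
[cite: NeukirchANT1999, Ch. I §9 (9.1), (9.4); Ch. II §9 Prop. (9.6)] -/
theorem forall_inertia_apply_eq_zero_of_localization_mem_unramifiedSubgroup
    (hρ : ramificationSubgroup K S ≤ ContinuousRep.ker ρ) (f : contOneCocycles ρ.toTopRep)
    {v : HeightOneSpectrum (𝓞 K)} (hv : v ∉ S)
    (hf : galoisCohomology.localization ρ (Sum.inr v) 1 (oneCocycleClass ρ.toTopRep f) ∈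
      unramifiedSubgroup (GaloisRep.toLocal v ρ) 1) :
    ∀ 𝔓 ∈ v.primesAbove, ∀ σ ∈ 𝔓.inertia (absoluteGaloisGroup K), f.1 σ = 0 := by
  have hN : ∀ σ ∈ ramificationSubgroup K S, ∀ m : M, ρ σ m = m := fun σ hσ m =>
    LinearMap.congr_fun ((ContinuousRep.mem_ker ρ σ).1 (hρ hσ)) m
  -- (a) the prime `𝔓_v` of the completion: `f` vanishes on `I_{𝔓_v} = res (I_{K_v})`
  have ha : ∀ σ ∈ (adicCompletionPrime K v).inertia (absoluteGaloisGroup K), f.1 σ = 0 := by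
    intro σ hσ
    rw [inertia_adicCompletionPrime_eq_map_absInertia] at hσ
    obtain ⟨τ, hτ, rfl⟩ := hσ
    have hI : ∀ τ ∈ absInertia (v.adicCompletion K), ∀ w : M, (GaloisRep.toLocal v ρ) τ w = w :=
      fun τ hτ w => hN _ (inertia_le_ramificationSubgroup hv (adicCompletionPrime_mem_primesAbove K v)
        (by rw [inertia_adicCompletionPrime_eq_map_absInertia]; exact ⟨τ, hτ, rfl⟩)) w
    have h1 : galoisCohomology.localization ρ (Sum.inr v) 1 (oneCocycleClass ρ.toTopRep f) =
        oneCocycleClass (DiscreteGaloisModule.toTopRep (GaloisRep.toLocal v ρ))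
          (contOneCocycles.pullback (absGaloisRestrict K (v.adicCompletion K)) (X := ρ.toTopRep)
            (Y := DiscreteGaloisModule.toTopRep (GaloisRep.toLocal v ρ))
            (TopRep.ofHom ⟨ContinuousLinearMap.id ℤ M, fun _ => rfl⟩) f) :=
      galoisCohomology.res_one_oneCocycleClass (v.adicCompletion K) f
    rw [h1] at hf
    change oneCocycleClass (DiscreteGaloisModule.toTopRep (GaloisRep.toLocal v ρ)) _ ∈
      unramifiedSubgroup (GaloisRep.toLocal v ρ) 1 at hf
    exact ((oneCocycleClass_mem_unramifiedSubgroup_iff_forall_eq_zero (GaloisRep.toLocal v ρ) hI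
      _).1 hf) τ hτ
  -- (b) the other primes above `v` are conjugate to `𝔓_v`
  intro 𝔓 h𝔓 σ hσ
  obtain ⟨g, hg⟩ := IsDedekindDomain.HeightOneSpectrum.exists_smul_eq_of_mem_primesAbove_holds
    (K := K) (v := v) (adicCompletionPrime_mem_primesAbove K v) h𝔓
  have hx : g⁻¹ * σ * g ∈ (adicCompletionPrime K v).inertia (absoluteGaloisGroup K) := by
    refine (Ideal.conj_mem_inertia_smul_iff (adicCompletionPrime K v) g (g⁻¹ * σ * g)).1 ?_
    rw [hg, show g * (g⁻¹ * σ * g) * g⁻¹ = σ by group]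
    exact hσ
  have hfx : f.1 (g⁻¹ * σ * g) = 0 := ha _ hx
  have hσN : g * (g⁻¹ * σ * g) * g⁻¹ ∈ ramificationSubgroup K S := by
    rw [show g * (g⁻¹ * σ * g) * g⁻¹ = σ by group]
    exact inertia_le_ramificationSubgroup hv h𝔓 hσ
  have key := contOneCocycles_apply_conj_of_mem_ramificationSubgroup ρ hρ f g (g⁻¹ * σ * g) hσN
  rw [show g * (g⁻¹ * σ * g) * g⁻¹ = σ by group, hfx, map_zero] at key
  exact key

/-! ### §2. Class level -/

/-- **A class of `H¹(K, M)` locally unramified at every finite `v ∉ S` is inflated from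
`H¹(G_S, M^{N_S})`**, for `M` unramified outside `S`. [cite: MilneADT2006, Ch. I §4 (p. 55) and Lemma 4.8]
[cite: NeukirchSchmidtWingberg2008, (1.6.7) and VIII §3] -/
theorem mem_range_restrictedInf_of_forall_localization_mem_unramifiedSubgroup
    (hur : GaloisRep.IsUnramifiedOutside S ρ) (c : galoisCohomology ρ 1)
    (hc : ∀ v : HeightOneSpectrum (𝓞 K), v ∉ S →
      galoisCohomology.localization ρ (Sum.inr v) 1 c ∈ unramifiedSubgroup (GaloisRep.toLocal v ρ) 1) :
    c ∈ Set.range (ρ.restrictedInf S 1) := by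
  have hρ : ramificationSubgroup K S ≤ ContinuousRep.ker ρ :=
    (ρ.isUnramifiedOutside_iff_ramificationSubgroup_le_ker S).1 hur
  obtain ⟨f, rfl⟩ := oneCocycleClass_surjective ρ.toTopRep c
  exact ρ.oneCocycleClass_mem_range_restrictedInf_of_forall_eq_zero S f
    (ρ.forall_ramificationSubgroup_eq_zero_of_forall_inertia hρ f fun v hv 𝔓 h𝔓 σ hσ =>
      ρ.forall_inertia_apply_eq_zero_of_localization_mem_unramifiedSubgroup hρ f hv (hc v hv)
        𝔓 h𝔓 σ hσ)

/-- **Converse: the localisation at a finite `v ∉ S` of a class inflated from `H¹(G_S, M^{N_S})` is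
unramified** (any discrete `M`): the inflated cocycle vanishes on `N_S ⊇ I_{𝔓_v} = res (I_{K_v})`.
[cite: MilneADT2006, Ch. I §4 (p. 55) and Lemma 4.8] [cite: NeukirchSchmidtWingberg2008, (1.6.7)] -/
theorem localization_mem_unramifiedSubgroup_of_mem_range_restrictedInf
    {v : HeightOneSpectrum (𝓞 K)} (hv : v ∉ S) {c : galoisCohomology ρ 1}
    (hc : c ∈ Set.range (ρ.restrictedInf S 1)) :
    galoisCohomology.localization ρ (Sum.inr v) 1 c ∈ unramifiedSubgroup (GaloisRep.toLocal v ρ) 1 := by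
  obtain ⟨y, rfl⟩ := hc
  obtain ⟨ψ, rfl⟩ := oneCocycleClass_surjective
    (ρ.quotientInvariants (ramificationSubgroup K S)).toTopRep y
  -- the inflated cocycle vanishes on `N_S`
  set f' := contOneCocycles.pullback (ContinuousMonoidHom.quotientMk (ramificationSubgroup K S))
    (X := (ρ.quotientInvariants (ramificationSubgroup K S)).toTopRep) (Y := ρ.toTopRep)
    (TopRep.ofHom ⟨Submodule.subtypeL _, fun _ => rfl⟩) ψ with hf'
  have hinf : ρ.restrictedInf S 1 (oneCocycleClass _ ψ) = oneCocycleClass ρ.toTopRep f' :=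
    map_oneCocycleClass _ _ _ ψ
  have hNS : ∀ σ ∈ ramificationSubgroup K S, f'.1 σ = 0 := fun σ hσ => by
    rw [hf', contOneCocycles.pullback_apply,
      show ContinuousMonoidHom.quotientMk (ramificationSubgroup K S) σ = 1 from
        (QuotientGroup.eq_one_iff _).mpr hσ,
      contOneCocycles.apply_one, map_zero]
  have h1 : galoisCohomology.localization ρ (Sum.inr v) 1 (oneCocycleClass ρ.toTopRep f') =
      oneCocycleClass (DiscreteGaloisModule.toTopRep (GaloisRep.toLocal v ρ))
        (contOneCocycles.pullback (absGaloisRestrict K (v.adicCompletion K)) (X := ρ.toTopRep)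
          (Y := DiscreteGaloisModule.toTopRep (GaloisRep.toLocal v ρ))
          (TopRep.ofHom ⟨ContinuousLinearMap.id ℤ M, fun _ => rfl⟩) f') :=
    galoisCohomology.res_one_oneCocycleClass (v.adicCompletion K) f'
  rw [hinf, h1]
  refine oneCocycleClass_mem_unramifiedSubgroup_of_vanishing (GaloisRep.toLocal v ρ) _ fun n => ?_
  rw [contOneCocycles.pullback_apply]
  change f'.1 (absGaloisRestrict K (v.adicCompletion K) n) = 0
  refine hNS _ (inertia_le_ramificationSubgroup hv (adicCompletionPrime_mem_primesAbove K v) ?_)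
  rw [inertia_adicCompletionPrime_eq_map_absInertia]
  exact ⟨n, n.2, rfl⟩

/-- **`H¹(G_S, M) = {c ∈ H¹(K, M) : loc_v c ∈ H¹_ur(K_v, M) for all finite v ∉ S}`** for a
`G_S`-module `M` (the image of `restrictedInf` in degree `1`, local form).
[cite: MilneADT2006, Ch. I §4 (p. 55) and Lemma 4.8] [cite: NeukirchSchmidtWingberg2008, (1.6.7) and VIII §3] -/
theorem mem_range_restrictedInf_iff_forall_localization_mem_unramifiedSubgroup
    (hur : GaloisRep.IsUnramifiedOutside S ρ) (c : galoisCohomology ρ 1) :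
    c ∈ Set.range (ρ.restrictedInf S 1) ↔
      ∀ v : HeightOneSpectrum (𝓞 K), v ∉ S →
        galoisCohomology.localization ρ (Sum.inr v) 1 c ∈ unramifiedSubgroup (GaloisRep.toLocal v ρ) 1 :=
  ⟨fun hc _ hv => ρ.localization_mem_unramifiedSubgroup_of_mem_range_restrictedInf hv hc,
    ρ.mem_range_restrictedInf_of_forall_localization_mem_unramifiedSubgroup hur c⟩

/-! ### §3. Selmer-structure form -/

/-- **A Selmer class for a structure unramified outside `T` is a class of `H¹(G_S, M)`** as soon as
every FINITE place of `T` lies in `S` (`M` a `G_S`-module): `x ∈ H¹_𝓖(K, M)` with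
`𝓖.IsUnramifiedOutside T` lies in the image of `restrictedInf`. [cite: Howard2004HeegnerKolyvagin, Def. 2.1.10 (arXiv:1202.6340 p. 6)]
[cite: MilneADT2006, Ch. I §4 (p. 55) and Lemma 4.8] -/
theorem mem_range_restrictedInf_of_mem_selmerGroup (hur : GaloisRep.IsUnramifiedOutside S ρ)
    {T : Finset (Place K)} (hT : ∀ v : HeightOneSpectrum (𝓞 K), (Sum.inr v : Place K) ∈ T → v ∈ S)
    {𝓖 : SelmerStructure ρ} (h𝓖 : 𝓖.IsUnramifiedOutside T) {x : galoisCohomology ρ 1}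
    (hx : x ∈ 𝓖.selmerGroup) :
    x ∈ Set.range (ρ.restrictedInf S 1) := by
  refine ρ.mem_range_restrictedInf_of_forall_localization_mem_unramifiedSubgroup hur x fun v hv => ?_
  have hvT : (Sum.inr v : Place K) ∉ T := fun h => hv (hT v h)
  have hxv := (SelmerStructure.mem_selmerGroup_iff 𝓖 x).1 hx (Sum.inr v)
  rw [h𝓖.2 v hvT] at hxv
  exact hxv

end DiscreteGaloisModule

end Literature.NumberTheory.GaloisRepresentations

end
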